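import Mathlib
import Summits.ResolutionOfSingularities.ResolutionOfSingularities.Theorems.WildQuotientsWildQuotientResolutionToricChartDefs

/-!
# Toric chart certificates — the presented cone ring is Noetherian, by name

(crux stmt-ResolutionOfSingularities-15640 `WildQuotients.WildQuotientResolution`, line `Sketch`,
sector `|G| = p`; RUNG V5 brick B5/HP₀ — plan-1 ORDER 2026-08-27T13:42:41Z: lead-1's one-shot
ring-brick binder `H₀′` carries an `IsNoetherianRing R₀` field for `R₀ = ToricChart.Ring k P D`;
this file exports it BY NAME (`IsDomain` is `ToricChart.isDomain_ring`, …ToricChartLemmas) so the assembler can cite them.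
[OURS · L1 W4.5c] — NOT a statement of any manuscript; replaces the role of no printed item.
Prover res-L1-w45c-stub-4 (gen 4).)
-/

-- single-problem summit: the doubled namespace component `ResolutionOfSingularities` is forced
set_option linter.dupNamespace false

noncomputable section

namespace Summit.ResolutionOfSingularities.ResolutionOfSingularities.Theorems.WildQuotientResolution.ToricChart

variable {d r : ℕ} (k : Type) [Field k] (P : Type) (D : ConeDatum d r)

/-- **The presented cone ring `k[Y] ⧸ ker` is Noetherian** for finitely many passengers (quotient of a
polynomial ring in finitely many variables over a field). [folklore] -/
theorem isNoetherianRing_ring [Finite P] : IsNoetherianRing (Ring k P D) := by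
  unfold Ring
  infer_instance

end Summit.ResolutionOfSingularities.ResolutionOfSingularities.Theorems.WildQuotientResolution.ToricChart

end
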